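import Literature.MathematicalPhysics.QuantumLattice.Imbrie2016.LLA

/-!
# Imbrie (2016): LLA(ν, C) ⟹ A2(ν′, ε₀) for every ν′ < ν, with an explicit ε₀ — REPRODUCTION (kernel-checked) of one sentence

CITATION HEADER (lean-in-tree rule 2026-08-18). J. Z. Imbrie, *On many-body localization for quantum spin chains*,
J. Stat. Phys. **163** (2016) 998–1048, doi 10.1007/s10955-016-1508-x, arXiv:1403.7837 [ImbrieJSP2016], §5, the sentence
after eq. (5.2): "Clearly, we may take δ = ε̃ⁿ in (5.2) and then for any ν′ < ν, LLA(ν, C) implies A2(ν′, ε₀), provided ε₀ is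
small enough (depending only on C, ν, ν′)."  WHAT IS REPRODUCED: exactly this implication, over the typed hypotheses
`LLA` (eq. (1.3) = (5.2)) and `A2` (eq. (5.1)) of `Imbrie2016/LLA.lean`, with the explicit admissible threshold
ε₀ = C^(−1/(ν−ν′)) (the paper gives no value).  The arithmetic: (ε̃ⁿ)^ν Cⁿ = ε̃^{ν′n} (ε̃^{ν−ν′} C)ⁿ ≤ ε̃^{ν′n} as soon as
ε̃^{ν−ν′} C ≤ 1, i.e. ε̃ ≤ C^{−1/(ν−ν′)}.  STATUS: this is the only elementary arrow of the paper's logical skeleton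
LLA ⟹ A2 ⟹ [Thm 5.1] MBL; it asserts nothing about LLA or A2 themselves (both remain unproved hypotheses, never asserted in the
tree).  Audit cell `pub-imbrie`, unit b2b-imbrie-2 (SURVIVAL.md §1 "b2b reproduction of the first arrow").
-/

noncomputable section
open _root_.MeasureTheory

namespace Literature.MathematicalPhysics.QuantumLattice.Imbrie2016

/-- The real inequality behind "ε₀ small enough depending only on C, ν, ν′": for 0 < C, ν′ < ν, 0 < ε ≤ C^(−1/(ν−ν′))
and every n, (εⁿ)^ν · Cⁿ ≤ ε^(ν′ n). [cite: ImbrieJSP2016, §5 after eq. (5.2)] -/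
theorem pow_rpow_mul_pow_le {C ν ν' ε : ℝ} (hC : 0 < C) (hν : ν' < ν) (hε : 0 < ε)
    (hε₀ : ε ≤ C ^ (-(1 / (ν - ν')))) (n : ℕ) :
    (ε ^ n) ^ ν * C ^ n ≤ ε ^ (ν' * n) := by
  have hd : 0 < ν - ν' := sub_pos.mpr hν
  have hCC : (C ^ (-(1 / (ν - ν')))) ^ (ν - ν') = C⁻¹ := by
    rw [← Real.rpow_mul hC.le]
    have : (-(1 / (ν - ν'))) * (ν - ν') = -1 := by field_simp
    rw [this, Real.rpow_neg_one]
  have h1 : ε ^ (ν - ν') * C ≤ 1 := by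
    have hle : ε ^ (ν - ν') ≤ (C ^ (-(1 / (ν - ν')))) ^ (ν - ν') :=
      Real.rpow_le_rpow hε.le hε₀ hd.le
    rw [hCC] at hle
    calc ε ^ (ν - ν') * C ≤ C⁻¹ * C := mul_le_mul_of_nonneg_right hle hC.le
      _ = 1 := inv_mul_cancel₀ hC.ne'
  have e1 : (ε ^ n) ^ ν = ε ^ (ν * n) := by
    rw [← Real.rpow_natCast ε n, ← Real.rpow_mul hε.le]
    congr 1; ring
  have e2 : ε ^ (ν * n) = ε ^ (ν' * n) * (ε ^ (ν - ν')) ^ n := by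
    rw [← Real.rpow_natCast (ε ^ (ν - ν')) n, ← Real.rpow_mul hε.le, ← Real.rpow_add hε]
    congr 1; ring
  rw [e1, e2, mul_assoc, ← mul_pow]
  have h2 : (ε ^ (ν - ν') * C) ^ n ≤ 1 := pow_le_one₀ (by positivity) h1
  calc ε ^ (ν' * (n : ℝ)) * (ε ^ (ν - ν') * C) ^ n ≤ ε ^ (ν' * (n : ℝ)) * 1 :=
        mul_le_mul_of_nonneg_left h2 (by positivity)
    _ = ε ^ (ν' * (n : ℝ)) := mul_one _

/-- **LLA(ν, C) ⟹ A2(ν′, ε₀)** for every ν′ < ν, with ε₀ = C^(−1/(ν−ν′)) (Imbrie 2016, §5, sentence after (5.2); the explicit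
ε₀ is this reproduction's).  Hypotheses only; neither side is asserted. [cite: ImbrieJSP2016, §5 after eq. (5.2)] -/
theorem A2_of_LLA {L : Laws} {γ ν ν' C : ℝ} (hC : 0 < C) (hν : ν' < ν) (h : LLA L γ ν C) :
    A2 L γ ν' (C ^ (-(1 / (ν - ν')))) := by
  intro a n hn ε' hε' hε₀
  refine (h a n hn (ε' ^ n) (pow_pos hε' n)).trans ?_
  exact ENNReal.ofReal_le_ofReal (pow_rpow_mul_pow_le hC hν hε' hε₀ n)

/-- The same with the paper's quantifier shape: some ε₀ > 0 depending only on (C, ν, ν′) works.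
[cite: ImbrieJSP2016, §5 after eq. (5.2)] -/
theorem exists_eps0_A2_of_LLA {L : Laws} {γ ν ν' C : ℝ} (hC : 0 < C) (hν : ν' < ν) (h : LLA L γ ν C) :
    ∃ ε₀ > 0, A2 L γ ν' ε₀ :=
  ⟨C ^ (-(1 / (ν - ν'))), Real.rpow_pos_of_pos hC _, A2_of_LLA hC hν h⟩

end Literature.MathematicalPhysics.QuantumLattice.Imbrie2016
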